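import Summits.QuantumFields.YangMills.Theorems.FluctuationComparisonRegPrIntLS2BetaSquareRadialProjection
import HarnessLib

/-!
# S2β · D-GUARD ∕ (BG∞) — (G7-S) FILE S1: THE PROPORTIONAL RADIAL PROJECTION OF THE DISCRETE CUBE `{0,…,n}³` — depth `dep = min(i, j, l, n−i, n−j, n−l)`, the
# coordinatewise central scaling `pr x κ = ⌊n·(x κ − dep x)∕(n − 2·dep x)⌋` of shell `dep x` onto the boundary shell, and THE DISTORTION LAW
# `(n∕2 − max depth)·|Δ pr|₁ ≤ 2n` along every bond — px5 g24's T1 ✓`…SquareRadialProjection.exists_squareProjection` ONE DIMENSION UP (stage S of UV3-NODE §116.3)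

Cell `ym3-torus` (YM ladder rung R3 = continuum `SU(2)` Yang–Mills on the three-torus at fixed lattice data — a RUNG: NOT d = 4, NOT infinite volume,
NOT a mass gap, NOT Clay).  Width seat «width 8» `ym3-torus-px8` (gen 28, toron∕flux lineage ✓p826411 → px17 (W1) ✓p837971), FREE px helper on crux
`stmt-QuantumFields-20520`; `--kind proof --supports stmt-QuantumFields-20520 --as helper`, count-neutral, DEFINITION-FREE (0 `def`, 0 `instance`, 0 `notation`,
0 `sorry`, default heartbeats).  NAMED (G7-S) by px5 g24 (STATUS 2026-09-01T01:21:46Z «(G7-S) IS YOURS, px8») under the architect's conditional GO (px17 g23 01:15:18Z (3)) and desk RULING №127 (P7-D) «binder style».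

WHY.  In the (BG∞) construction of the volume-uniform small-bond gauge `hBG`∕`hsuppPlus` (UV3-NODE §116; desk RULING №127; px19 g25's descent formulation §116 ADD 1) the
class-111 blocks are filled at STAGE S by CONING the datum on the boundary 2-sphere of a discrete cube toward an antipodal centre (✓p839220, ✓p839271 `dist1_coneFill_*`):
site `x` of depth `k` receives `cone(1 − k∕K; φ(pr x))`, and the step bound of the filling needs the projection `pr` to expand lattice distances by at most `≍ n∕(n−2k)` —
exactly the factor the cone's depth parameter `1 − k∕(n∕2)` cancels.  px5's T1 does this for the square (stage T, slices); THIS FILE is the cube (stage S, shells), with the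
SAME coordinatewise projection (corners∕edges of shell `k` go to corners∕edges of shell `0` exactly — no face bookkeeping) and the same floor arithmetic (imported, not
restated).  The one difference: in a depth-changing move TWO transverse coordinates cross the denominators `m ↔ m − 2`, so the law's constant is `2n` (same-depth moves `≤ n`).

WHAT IS PROVED (sorry-free; pure `ℕ`; def-free, binder-style ∃-export; T1's clause list one dimension up).
* §1 depth: `dep_le_half`, `dep_eq_zero_iff` (boundary shell), `dep_succ_le`∕`dep_le_succ` (unit variation), `dep_swap12`∕`dep_swap13` (coordinate symmetry); `min6_cases`,
  `min6_le` (the six-fold minimum, extracted once so that no proof re-splits the `min`s).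
* §2 ★ `pr_mem_boundary` (one projected coordinate is `0` or `n`, all `≤ n`), ★ `pr_eq_self_of_boundary`.
* §3 `mul_add_le_of_two_mul_le`, `cross_dist_le` (T1's `cross_floor_le_one∕two` in `Nat.dist` currency), ★★★ `distortion_fst` (the law along the first direction: same depth —
  one proportional step; `k → k ± 1` — the moving coordinate pinned at a corner value, the other two across `m ↔ m − 2`), ★★★ `distortion_snd`∕`distortion_thd` (by the
  coordinate symmetries).
* §4 ★★★ `exists_cubeProjection (n) (hn : 2 ≤ n) : ∃ dep pr, (dep-equation) ∧ (dep ≤ n∕2) ∧ (dep = 0 ↔ shell) ∧ (pr on the shell, coords ≤ n) ∧ (pr = id on the shell) ∧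
  (unit variation ×3) ∧ (distortion ×3, `≤ 2·n`)` — the BINDER-STYLE export for S2 «the cone on a discrete cube» (px5's dimension-free T2 core consumes `D := |Δ pr|₁`
  with the constant `2`).

HONEST SCOPE.  Elementary `ℕ` geometry (floor brackets, `omega`); nothing of Bałaban's renormalisation-group analysis is asserted, proved or refuted ([Balaban1985RegularSpaces]
Lemma 1 p.79 ∕ Thm 2 p.83 fix LOCAL small-bond gauges on cubes — the object this road globalises; consistent, not used); `hBG`∕`hsuppPlus` remains a CONJECTURE under
construction ((G1)–(G5), (G4→G5), (G7)ᵃᵇˢ ×2, (G6) ✓∕⧗; (G7)-lattice T∕S, (G8), assembly open); GAP♯∘ (`stub_uniformFibreGapOrbit`; registry v11 3732b7df, v12.1 adopted-in-waiting),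
the five registered stubs (0∕5), S2β, crux 20520, 19936, 19200, `YM3TorusSU2` are NOT proved; no registered stub is closed; rung R3 = `SU(2)` YM₃ on T³ at fixed lattice data —
NOT d = 4, NOT infinite volume, NOT a mass gap, NOT Clay; the Yang–Mills mass gap is NOT proved.  Axioms standard.
References: T. Bałaban, CMP **99** (1985) 75–102 [Balaban1985RegularSpaces] (Lemma 1 p.79, Thm 2 p.83: local axial gauges on cubes).
-/

set_option autoImplicit false

namespace Summit.QuantumFields.YangMills.Theorems.FluctuationComparisonRegPrIntLS2BetaCubeRadialProjection

open Summit.QuantumFields.YangMills.Theorems.FluctuationComparisonRegPrIntLS2BetaSquareRadialProjection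
  (mul_floor_step_le cross_floor_le_one cross_floor_le_two mul_le_of_two_mul_le f_self f_far f_le f_zero_depth)

/-! ## §1 Depth on the cube `{0,…,n}³`: `dep i j l = min(i, j, l, n−i, n−j, n−l)` -/

/-- In the cube the depth is at most `n ∕ 2`. [folklore] -/
theorem dep_le_half (n i j l : ℕ) (hi : i ≤ n) (hj : j ≤ n) (hl : l ≤ n) :
    min (min (min i j) l) (min (min (n - i) (n - j)) (n - l)) ≤ n / 2 := by
  omega

/-- Depth `0` is the boundary shell. [folklore] -/
theorem dep_eq_zero_iff (n i j l : ℕ) (hi : i ≤ n) (hj : j ≤ n) (hl : l ≤ n) :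
    min (min (min i j) l) (min (min (n - i) (n - j)) (n - l)) = 0 ↔ (i = 0 ∨ i = n ∨ j = 0 ∨ j = n ∨ l = 0 ∨ l = n) := by
  omega

/-- Along a bond in the first direction the depth changes by at most one. [folklore] -/
theorem dep_succ_le (n i j l : ℕ) :
    min (min (min (i + 1) j) l) (min (min (n - (i + 1)) (n - j)) (n - l)) ≤ min (min (min i j) l) (min (min (n - i) (n - j)) (n - l)) + 1 := by
  omega

/-- Along a bond in the first direction the depth changes by at most one (other direction). [folklore] -/
theorem dep_le_succ (n i j l : ℕ) :
    min (min (min i j) l) (min (min (n - i) (n - j)) (n - l)) ≤ min (min (min (i + 1) j) l) (min (min (n - (i + 1)) (n - j)) (n - l)) + 1 := by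
  omega

/-- The depth is symmetric under swapping the first two coordinates. [folklore] -/
theorem dep_swap12 (n i j l : ℕ) :
    min (min (min j i) l) (min (min (n - j) (n - i)) (n - l)) = min (min (min i j) l) (min (min (n - i) (n - j)) (n - l)) := by
  rw [min_comm j i, min_comm (n - j) (n - i)]

/-- The depth is symmetric under swapping the first and third coordinates. [folklore] -/
theorem dep_swap13 (n i j l : ℕ) :
    min (min (min l j) i) (min (min (n - l) (n - j)) (n - i)) = min (min (min i j) l) (min (min (n - i) (n - j)) (n - l)) := by
  omega

/-- The six-fold minimum is one of its six arguments. [folklore] -/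
theorem min6_cases (a b c d e f : ℕ) :
    min (min (min a b) c) (min (min d e) f) = a ∨ min (min (min a b) c) (min (min d e) f) = b ∨
      min (min (min a b) c) (min (min d e) f) = c ∨ min (min (min a b) c) (min (min d e) f) = d ∨
      min (min (min a b) c) (min (min d e) f) = e ∨ min (min (min a b) c) (min (min d e) f) = f := by
  rcases min_choice (min (min a b) c) (min (min d e) f) with h | h <;> rw [h]
  · rcases min_choice (min a b) c with h2 | h2 <;> rw [h2]
    · rcases min_choice a b with h3 | h3 <;> rw [h3] <;> simp
    · simp
  · rcases min_choice (min d e) f with h2 | h2 <;> rw [h2]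
    · rcases min_choice d e with h3 | h3 <;> rw [h3] <;> simp
    · simp

/-- The six-fold minimum is below each of its six arguments. [folklore] -/
theorem min6_le (a b c d e f : ℕ) :
    min (min (min a b) c) (min (min d e) f) ≤ a ∧ min (min (min a b) c) (min (min d e) f) ≤ b ∧
      min (min (min a b) c) (min (min d e) f) ≤ c ∧ min (min (min a b) c) (min (min d e) f) ≤ d ∧
      min (min (min a b) c) (min (min d e) f) ≤ e ∧ min (min (min a b) c) (min (min d e) f) ≤ f := by
  refine ⟨?_, ?_, ?_, ?_, ?_, ?_⟩ <;> simp

/-! ## §2 The projection lands on the boundary shell and fixes it -/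

/-- ★ **THE PROJECTION LANDS ON THE BOUNDARY SHELL**: for a site of the cube, one projected coordinate is `0` or `n` and all three are `≤ n` (at depth `k` one of the six
numbers `i, j, l, n−i, n−j, n−l` equals `k`; that coordinate maps to `0` or `n`; at the centre `n − 2k = 0` and the projection is `(0,0,0)` by ℕ-division). [folklore] -/
theorem pr_mem_boundary (n i j l : ℕ) (hi : i ≤ n) (hj : j ≤ n) (hl : l ≤ n) :
    (n * (i - min (min (min i j) l) (min (min (n - i) (n - j)) (n - l))) / (n - 2 * min (min (min i j) l) (min (min (n - i) (n - j)) (n - l))) = 0 ∨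
      n * (i - min (min (min i j) l) (min (min (n - i) (n - j)) (n - l))) / (n - 2 * min (min (min i j) l) (min (min (n - i) (n - j)) (n - l))) = n ∨
      n * (j - min (min (min i j) l) (min (min (n - i) (n - j)) (n - l))) / (n - 2 * min (min (min i j) l) (min (min (n - i) (n - j)) (n - l))) = 0 ∨
      n * (j - min (min (min i j) l) (min (min (n - i) (n - j)) (n - l))) / (n - 2 * min (min (min i j) l) (min (min (n - i) (n - j)) (n - l))) = n ∨
      n * (l - min (min (min i j) l) (min (min (n - i) (n - j)) (n - l))) / (n - 2 * min (min (min i j) l) (min (min (n - i) (n - j)) (n - l))) = 0 ∨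
      n * (l - min (min (min i j) l) (min (min (n - i) (n - j)) (n - l))) / (n - 2 * min (min (min i j) l) (min (min (n - i) (n - j)) (n - l))) = n) ∧
    n * (i - min (min (min i j) l) (min (min (n - i) (n - j)) (n - l))) / (n - 2 * min (min (min i j) l) (min (min (n - i) (n - j)) (n - l))) ≤ n ∧
    n * (j - min (min (min i j) l) (min (min (n - i) (n - j)) (n - l))) / (n - 2 * min (min (min i j) l) (min (min (n - i) (n - j)) (n - l))) ≤ n ∧
    n * (l - min (min (min i j) l) (min (min (n - i) (n - j)) (n - l))) / (n - 2 * min (min (min i j) l) (min (min (n - i) (n - j)) (n - l))) ≤ n := by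
  set k := min (min (min i j) l) (min (min (n - i) (n - j)) (n - l)) with hk
  have hki : k ≤ i := by omega
  have hkj : k ≤ j := by omega
  have hkl : k ≤ l := by omega
  have hik : i ≤ n - k := by omega
  have hjk : j ≤ n - k := by omega
  have hlk : l ≤ n - k := by omega
  refine ⟨?_, f_le n k i hki hik, f_le n k j hkj hjk, f_le n k l hkl hlk⟩
  rcases Nat.eq_zero_or_pos (n - 2 * k) with h0 | hm
  · left; rw [h0, Nat.div_zero]
  · have hk2 : 2 * k < n := by omega
    -- one of the six numbers realises the minimum
    have hcases : i = k ∨ i = n - k ∨ j = k ∨ j = n - k ∨ l = k ∨ l = n - k := by omega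
    rcases hcases with h | h | h | h | h | h
    · exact Or.inl (by rw [h, f_self])
    · exact Or.inr (Or.inl (by rw [h, f_far n k hk2]))
    · exact Or.inr (Or.inr (Or.inl (by rw [h, f_self])))
    · exact Or.inr (Or.inr (Or.inr (Or.inl (by rw [h, f_far n k hk2]))))
    · exact Or.inr (Or.inr (Or.inr (Or.inr (Or.inl (by rw [h, f_self])))))
    · exact Or.inr (Or.inr (Or.inr (Or.inr (Or.inr (by rw [h, f_far n k hk2])))))

/-- ★ **THE PROJECTION FIXES THE BOUNDARY SHELL**: at depth `0` all three coordinates are returned unchanged (`0 < n`). [folklore] -/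
theorem pr_eq_self_of_boundary (n i j l : ℕ) (hn : 0 < n) (hi : i ≤ n) (hj : j ≤ n) (hl : l ≤ n)
    (hb : i = 0 ∨ i = n ∨ j = 0 ∨ j = n ∨ l = 0 ∨ l = n) :
    n * (i - min (min (min i j) l) (min (min (n - i) (n - j)) (n - l))) / (n - 2 * min (min (min i j) l) (min (min (n - i) (n - j)) (n - l))) = i ∧
    n * (j - min (min (min i j) l) (min (min (n - i) (n - j)) (n - l))) / (n - 2 * min (min (min i j) l) (min (min (n - i) (n - j)) (n - l))) = j ∧
    n * (l - min (min (min i j) l) (min (min (n - i) (n - j)) (n - l))) / (n - 2 * min (min (min i j) l) (min (min (n - i) (n - j)) (n - l))) = l := by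
  have hk : min (min (min i j) l) (min (min (n - i) (n - j)) (n - l)) = 0 := (dep_eq_zero_iff n i j l hi hj hl).2 hb
  rw [hk]
  exact ⟨f_zero_depth n i hn, f_zero_depth n j hn, f_zero_depth n l hn⟩

/-! ## §3 The distortion law along a bond: `(n∕2 − max depth)·|Δ pr|₁ ≤ 2n` -/

/-- From `c·D₁ ≤ 2n`, `c·D₂ ≤ 2n` and `2a ≤ c` conclude `a·(D₁ + D₂) ≤ 2n` (two transverse coordinates cross the denominators). [folklore] -/
theorem mul_add_le_of_two_mul_le {a c D₁ D₂ n : ℕ} (hac : 2 * a ≤ c) (h1 : c * D₁ ≤ 2 * n) (h2 : c * D₂ ≤ 2 * n) :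
    a * (D₁ + D₂) ≤ 2 * n := by
  have h : 2 * (a * (D₁ + D₂)) ≤ 2 * n + 2 * n :=
    calc 2 * (a * (D₁ + D₂)) = (2 * a) * D₁ + (2 * a) * D₂ := by ring
      _ ≤ c * D₁ + c * D₂ := Nat.add_le_add (Nat.mul_le_mul_right _ hac) (Nat.mul_le_mul_right _ hac)
      _ ≤ 2 * n + 2 * n := Nat.add_le_add h1 h2
  omega

/-- The transverse coordinate across the two denominators `m ↔ m − 2` (`m = n − 2k > 2`, `1 ≤ u`, `u + 1 ≤ m`): `(m−2)·|⌊nu∕m⌋ − ⌊n(u−1)∕(m−2)⌋| ≤ 2n` in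
`Nat.dist` currency (T1's `cross_floor_le_one∕two`). [folklore] -/
theorem cross_dist_le (n m u : ℕ) (hm : 2 < m) (hmn : m ≤ n) (hu1 : 1 ≤ u) (hum : u + 1 ≤ m) :
    (m - 2) * Nat.dist (n * u / m) (n * (u - 1) / (m - 2)) ≤ 2 * n := by
  rcases le_total (n * u / m) (n * (u - 1) / (m - 2)) with hle | hle
  · rw [Nat.dist_eq_sub_of_le hle]; exact cross_floor_le_two n m u hm hmn hu1 hum
  · rw [Nat.dist_eq_sub_of_le_right hle]; exact cross_floor_le_one n m u hm hmn hu1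

/-- ★★★ **THE DISTORTION LAW ALONG A BOND IN THE FIRST DIRECTION**: for `x = (i, j, l)`, `y = (i+1, j, l)` in the cube,
`(n∕2 − max (dep x) (dep y)) · (|Δ pr₁| + |Δ pr₂| + |Δ pr₃|) ≤ 2n` (same depth: one proportional step of the first coordinate, `≤ n`; depth `k → k ± 1`: `x` resp. `y`
sits on the face `i = k` resp. `i + 1 = n − k`, the first coordinate is fixed at a corner value and the TWO transverse coordinates cross the denominators `m ↔ m − 2`,
`≤ n` each after the factor). [folklore] -/
theorem distortion_fst (n i j l : ℕ) (hi : i + 1 ≤ n) (hj : j ≤ n) (hl : l ≤ n) :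
    (n / 2 - max (min (min (min i j) l) (min (min (n - i) (n - j)) (n - l)))
        (min (min (min (i + 1) j) l) (min (min (n - (i + 1)) (n - j)) (n - l)))) *
      (Nat.dist (n * (i - min (min (min i j) l) (min (min (n - i) (n - j)) (n - l))) / (n - 2 * min (min (min i j) l) (min (min (n - i) (n - j)) (n - l))))
          (n * ((i + 1) - min (min (min (i + 1) j) l) (min (min (n - (i + 1)) (n - j)) (n - l))) /
            (n - 2 * min (min (min (i + 1) j) l) (min (min (n - (i + 1)) (n - j)) (n - l)))) +
        Nat.dist (n * (j - min (min (min i j) l) (min (min (n - i) (n - j)) (n - l))) / (n - 2 * min (min (min i j) l) (min (min (n - i) (n - j)) (n - l))))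
          (n * (j - min (min (min (i + 1) j) l) (min (min (n - (i + 1)) (n - j)) (n - l))) /
            (n - 2 * min (min (min (i + 1) j) l) (min (min (n - (i + 1)) (n - j)) (n - l)))) +
        Nat.dist (n * (l - min (min (min i j) l) (min (min (n - i) (n - j)) (n - l))) / (n - 2 * min (min (min i j) l) (min (min (n - i) (n - j)) (n - l))))
          (n * (l - min (min (min (i + 1) j) l) (min (min (n - (i + 1)) (n - j)) (n - l))) /
            (n - 2 * min (min (min (i + 1) j) l) (min (min (n - (i + 1)) (n - j)) (n - l))))) ≤ 2 * n := by
  -- the linear content of the two depths, extracted once; then the `min`s are generalised away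
  have hX := min6_le i j l (n - i) (n - j) (n - l)
  have hX7 := min6_cases i j l (n - i) (n - j) (n - l)
  have hY := min6_le (i + 1) j l (n - (i + 1)) (n - j) (n - l)
  have hY7 := min6_cases (i + 1) j l (n - (i + 1)) (n - j) (n - l)
  have hs1 := dep_succ_le n i j l
  have hs2 := dep_le_succ n i j l
  generalize min (min (min i j) l) (min (min (n - i) (n - j)) (n - l)) = kx at hX hX7 hs1 hs2 ⊢
  generalize min (min (min (i + 1) j) l) (min (min (n - (i + 1)) (n - j)) (n - l)) = ky at hY hY7 hs1 hs2 ⊢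
  obtain ⟨hx1, hx2, hx3, hx4, hx5, hx6⟩ := hX
  obtain ⟨hy1, hy2, hy3, hy4, hy5, hy6⟩ := hY
  by_cases hfac : n / 2 - max kx ky = 0
  · rw [hfac, zero_mul]; exact Nat.zero_le _
  have hkx2 : kx < n / 2 := by omega
  have hky2 : ky < n / 2 := by omega
  have hcases : kx = ky ∨ ky = kx + 1 ∨ kx = ky + 1 := by omega
  rcases hcases with h | h | h
  · -- same depth `k`: the transverse coordinates agree, the first moves by one proportional step
    subst h
    clear hX7 hY7
    have hm : 0 < n - 2 * kx := by omega
    rw [max_self, Nat.dist_self, Nat.dist_self, add_zero, add_zero]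
    have hmono : n * (i - kx) / (n - 2 * kx) ≤ n * (i + 1 - kx) / (n - 2 * kx) :=
      Nat.div_le_div_right (Nat.mul_le_mul_left n (by omega))
    rw [Nat.dist_eq_sub_of_le hmono, show i + 1 - kx = (i - kx) + 1 by omega]
    have hstep := mul_floor_step_le n (n - 2 * kx) (i - kx) hm
    refine le_trans ?_ (show n ≤ 2 * n by omega)
    exact mul_le_of_two_mul_le (c := n - 2 * kx) (by omega) (by omega)
  · -- depth `k → k+1`: `x` sits on the face `i = k`; the first coordinate is pinned at `0`, the other two cross the denominators
    subst h
    have hik : i = kx := by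
      rcases hX7 with h7 | h7 | h7 | h7 | h7 | h7 <;> omega
    clear hX7 hY7
    have hm3 : 2 < n - 2 * kx := by omega
    have huj : 1 ≤ j - kx := by omega
    have hujm : j - kx + 1 ≤ n - 2 * kx := by omega
    have hul : 1 ≤ l - kx := by omega
    have hulm : l - kx + 1 ≤ n - 2 * kx := by omega
    rw [max_eq_right (Nat.le_succ _)]
    have h1x : n * (i - kx) / (n - 2 * kx) = 0 := by rw [hik, Nat.sub_self, mul_zero, Nat.zero_div]
    have h1y : n * (i + 1 - (kx + 1)) / (n - 2 * (kx + 1)) = 0 := by rw [hik, Nat.sub_self, mul_zero, Nat.zero_div]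
    rw [h1x, h1y, Nat.dist_self, zero_add]
    have hden : n - 2 * (kx + 1) = n - 2 * kx - 2 := by omega
    have hnumj : j - (kx + 1) = j - kx - 1 := by omega
    have hnuml : l - (kx + 1) = l - kx - 1 := by omega
    rw [hden, hnumj, hnuml]
    exact mul_add_le_of_two_mul_le (c := n - 2 * kx - 2) (by omega)
      (cross_dist_le n (n - 2 * kx) (j - kx) hm3 (by omega) huj hujm)
      (cross_dist_le n (n - 2 * kx) (l - kx) hm3 (by omega) hul hulm)
  · -- depth `k+1 → k` (`x` deeper): `y` sits on the face `i + 1 = n − k`; mirror of the previous case with the roles of `x`, `y` swapped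
    subst h
    have hik : i = n - (ky + 1) := by
      rcases hY7 with h7 | h7 | h7 | h7 | h7 | h7 <;> omega
    clear hX7 hY7
    have hm3 : 2 < n - 2 * ky := by omega
    have huj : 1 ≤ j - ky := by omega
    have hujm : j - ky + 1 ≤ n - 2 * ky := by omega
    have hul : 1 ≤ l - ky := by omega
    have hulm : l - ky + 1 ≤ n - 2 * ky := by omega
    rw [max_eq_left (Nat.le_succ _)]
    have hmx : 0 < n - 2 * (ky + 1) := by omega
    have hmy : 0 < n - 2 * ky := by omega
    have h1x : n * (i - (ky + 1)) / (n - 2 * (ky + 1)) = n := by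
      rw [show i - (ky + 1) = n - 2 * (ky + 1) by omega, Nat.mul_div_cancel _ hmx]
    have h1y : n * (i + 1 - ky) / (n - 2 * ky) = n := by
      rw [show i + 1 - ky = n - 2 * ky by omega, Nat.mul_div_cancel _ hmy]
    rw [h1x, h1y, Nat.dist_self, zero_add]
    have hden : n - 2 * (ky + 1) = n - 2 * ky - 2 := by omega
    have hnumj : j - (ky + 1) = j - ky - 1 := by omega
    have hnuml : l - (ky + 1) = l - ky - 1 := by omega
    rw [hden, hnumj, hnuml, Nat.dist_comm (n * (j - ky - 1) / (n - 2 * ky - 2)), Nat.dist_comm (n * (l - ky - 1) / (n - 2 * ky - 2))]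
    exact mul_add_le_of_two_mul_le (c := n - 2 * ky - 2) (by omega)
      (cross_dist_le n (n - 2 * ky) (j - ky) hm3 (by omega) huj hujm)
      (cross_dist_le n (n - 2 * ky) (l - ky) hm3 (by omega) hul hulm)

/-- ★★★ **THE DISTORTION LAW ALONG A BOND IN THE SECOND DIRECTION** (`x = (i, j, l)`, `y = (i, j+1, l)`), by the swap symmetry `i ↔ j`. [folklore] -/
theorem distortion_snd (n i j l : ℕ) (hi : i ≤ n) (hj : j + 1 ≤ n) (hl : l ≤ n) :
    (n / 2 - max (min (min (min i j) l) (min (min (n - i) (n - j)) (n - l)))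
        (min (min (min i (j + 1)) l) (min (min (n - i) (n - (j + 1))) (n - l)))) *
      (Nat.dist (n * (i - min (min (min i j) l) (min (min (n - i) (n - j)) (n - l))) / (n - 2 * min (min (min i j) l) (min (min (n - i) (n - j)) (n - l))))
          (n * (i - min (min (min i (j + 1)) l) (min (min (n - i) (n - (j + 1))) (n - l))) /
            (n - 2 * min (min (min i (j + 1)) l) (min (min (n - i) (n - (j + 1))) (n - l)))) +
        Nat.dist (n * (j - min (min (min i j) l) (min (min (n - i) (n - j)) (n - l))) / (n - 2 * min (min (min i j) l) (min (min (n - i) (n - j)) (n - l))))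
          (n * ((j + 1) - min (min (min i (j + 1)) l) (min (min (n - i) (n - (j + 1))) (n - l))) /
            (n - 2 * min (min (min i (j + 1)) l) (min (min (n - i) (n - (j + 1))) (n - l)))) +
        Nat.dist (n * (l - min (min (min i j) l) (min (min (n - i) (n - j)) (n - l))) / (n - 2 * min (min (min i j) l) (min (min (n - i) (n - j)) (n - l))))
          (n * (l - min (min (min i (j + 1)) l) (min (min (n - i) (n - (j + 1))) (n - l))) /
            (n - 2 * min (min (min i (j + 1)) l) (min (min (n - i) (n - (j + 1))) (n - l))))) ≤ 2 * n := by
  have h := distortion_fst n j i l hj hi hl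
  rw [dep_swap12 n i j l, dep_swap12 n i (j + 1) l] at h
  -- reorder the summands: (j, i, l) ↦ (i, j, l)
  rwa [add_comm (Nat.dist _ _) (Nat.dist _ _)] at h

/-- ★★★ **THE DISTORTION LAW ALONG A BOND IN THE THIRD DIRECTION** (`x = (i, j, l)`, `y = (i, j, l+1)`), by the swap symmetry `i ↔ l`. [folklore] -/
theorem distortion_thd (n i j l : ℕ) (hi : i ≤ n) (hj : j ≤ n) (hl : l + 1 ≤ n) :
    (n / 2 - max (min (min (min i j) l) (min (min (n - i) (n - j)) (n - l)))
        (min (min (min i j) (l + 1)) (min (min (n - i) (n - j)) (n - (l + 1))))) *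
      (Nat.dist (n * (i - min (min (min i j) l) (min (min (n - i) (n - j)) (n - l))) / (n - 2 * min (min (min i j) l) (min (min (n - i) (n - j)) (n - l))))
          (n * (i - min (min (min i j) (l + 1)) (min (min (n - i) (n - j)) (n - (l + 1)))) /
            (n - 2 * min (min (min i j) (l + 1)) (min (min (n - i) (n - j)) (n - (l + 1))))) +
        Nat.dist (n * (j - min (min (min i j) l) (min (min (n - i) (n - j)) (n - l))) / (n - 2 * min (min (min i j) l) (min (min (n - i) (n - j)) (n - l))))
          (n * (j - min (min (min i j) (l + 1)) (min (min (n - i) (n - j)) (n - (l + 1)))) /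
            (n - 2 * min (min (min i j) (l + 1)) (min (min (n - i) (n - j)) (n - (l + 1))))) +
        Nat.dist (n * (l - min (min (min i j) l) (min (min (n - i) (n - j)) (n - l))) / (n - 2 * min (min (min i j) l) (min (min (n - i) (n - j)) (n - l))))
          (n * ((l + 1) - min (min (min i j) (l + 1)) (min (min (n - i) (n - j)) (n - (l + 1)))) /
            (n - 2 * min (min (min i j) (l + 1)) (min (min (n - i) (n - j)) (n - (l + 1)))))) ≤ 2 * n := by
  have h := distortion_fst n l j i hl hj hi
  rw [dep_swap13 n i j l, dep_swap13 n i j (l + 1)] at h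
  -- reorder the three summands: (l, j, i) ↦ (i, j, l)
  rwa [add_comm (Nat.dist _ _) (Nat.dist _ _), add_comm (Nat.dist _ _ + Nat.dist _ _) (Nat.dist _ _), ← add_assoc] at h

/-! ## §4 The binder-style export -/

/-- ★★★ **THE PROPORTIONAL RADIAL PROJECTION OF THE DISCRETE CUBE** (binder style, T1 ✓`exists_squareProjection` one dimension up): for `n ≥ 2` there are a depth
`dep` and a projection `pr` on `ℕ × ℕ × ℕ` with — on the cube `i, j, l ≤ n` — `dep = min(i, j, l, n−i, n−j, n−l)` (so `≤ n∕2`, `= 0` exactly on the boundary shell,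
unit variation along bonds), `pr` landing on the boundary shell and fixing it, and THE DISTORTION LAW `(n∕2 − max depth)·|Δ pr|₁ ≤ 2n` along every bond of the three
directions. [folklore] -/
theorem exists_cubeProjection (n : ℕ) (hn : 2 ≤ n) :
    ∃ (dep : ℕ → ℕ → ℕ → ℕ) (pr : ℕ → ℕ → ℕ → ℕ × ℕ × ℕ),
      (∀ i j l, dep i j l = min (min (min i j) l) (min (min (n - i) (n - j)) (n - l))) ∧
      (∀ i j l, i ≤ n → j ≤ n → l ≤ n → dep i j l ≤ n / 2) ∧
      (∀ i j l, i ≤ n → j ≤ n → l ≤ n → (dep i j l = 0 ↔ (i = 0 ∨ i = n ∨ j = 0 ∨ j = n ∨ l = 0 ∨ l = n))) ∧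
      (∀ i j l, i ≤ n → j ≤ n → l ≤ n →
        ((pr i j l).1 = 0 ∨ (pr i j l).1 = n ∨ (pr i j l).2.1 = 0 ∨ (pr i j l).2.1 = n ∨ (pr i j l).2.2 = 0 ∨ (pr i j l).2.2 = n) ∧
          (pr i j l).1 ≤ n ∧ (pr i j l).2.1 ≤ n ∧ (pr i j l).2.2 ≤ n) ∧
      (∀ i j l, i ≤ n → j ≤ n → l ≤ n → (i = 0 ∨ i = n ∨ j = 0 ∨ j = n ∨ l = 0 ∨ l = n) → pr i j l = (i, j, l)) ∧
      (∀ i j l, dep (i + 1) j l ≤ dep i j l + 1 ∧ dep i j l ≤ dep (i + 1) j l + 1) ∧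
      (∀ i j l, dep i (j + 1) l ≤ dep i j l + 1 ∧ dep i j l ≤ dep i (j + 1) l + 1) ∧
      (∀ i j l, dep i j (l + 1) ≤ dep i j l + 1 ∧ dep i j l ≤ dep i j (l + 1) + 1) ∧
      (∀ i j l, i + 1 ≤ n → j ≤ n → l ≤ n →
        (n / 2 - max (dep i j l) (dep (i + 1) j l)) *
          (Nat.dist (pr i j l).1 (pr (i + 1) j l).1 + Nat.dist (pr i j l).2.1 (pr (i + 1) j l).2.1 +
            Nat.dist (pr i j l).2.2 (pr (i + 1) j l).2.2) ≤ 2 * n) ∧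
      (∀ i j l, i ≤ n → j + 1 ≤ n → l ≤ n →
        (n / 2 - max (dep i j l) (dep i (j + 1) l)) *
          (Nat.dist (pr i j l).1 (pr i (j + 1) l).1 + Nat.dist (pr i j l).2.1 (pr i (j + 1) l).2.1 +
            Nat.dist (pr i j l).2.2 (pr i (j + 1) l).2.2) ≤ 2 * n) ∧
      (∀ i j l, i ≤ n → j ≤ n → l + 1 ≤ n →
        (n / 2 - max (dep i j l) (dep i j (l + 1))) *
          (Nat.dist (pr i j l).1 (pr i j (l + 1)).1 + Nat.dist (pr i j l).2.1 (pr i j (l + 1)).2.1 +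
            Nat.dist (pr i j l).2.2 (pr i j (l + 1)).2.2) ≤ 2 * n) := by
  have hn0 : 0 < n := by omega
  refine ⟨fun i j l => min (min (min i j) l) (min (min (n - i) (n - j)) (n - l)),
    fun i j l =>
      (n * (i - min (min (min i j) l) (min (min (n - i) (n - j)) (n - l))) / (n - 2 * min (min (min i j) l) (min (min (n - i) (n - j)) (n - l))),
       n * (j - min (min (min i j) l) (min (min (n - i) (n - j)) (n - l))) / (n - 2 * min (min (min i j) l) (min (min (n - i) (n - j)) (n - l))),
       n * (l - min (min (min i j) l) (min (min (n - i) (n - j)) (n - l))) / (n - 2 * min (min (min i j) l) (min (min (n - i) (n - j)) (n - l)))),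
    fun _ _ _ => rfl, fun i j l hi hj hl => dep_le_half n i j l hi hj hl, fun i j l hi hj hl => dep_eq_zero_iff n i j l hi hj hl,
    fun i j l hi hj hl => pr_mem_boundary n i j l hi hj hl, fun i j l hi hj hl hb => ?_,
    fun i j l => ⟨dep_succ_le n i j l, dep_le_succ n i j l⟩, fun i j l => ?_, fun i j l => ?_,
    fun i j l hi hj hl => distortion_fst n i j l hi hj hl, fun i j l hi hj hl => distortion_snd n i j l hi hj hl,
    fun i j l hi hj hl => distortion_thd n i j l hi hj hl⟩
  · obtain ⟨h1, h2, h3⟩ := pr_eq_self_of_boundary n i j l hn0 hi hj hl hb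
    exact Prod.ext h1 (Prod.ext h2 h3)
  · have h1 := dep_succ_le n j i l
    have h2 := dep_le_succ n j i l
    rw [dep_swap12 n i j l, dep_swap12 n i (j + 1) l] at h1 h2
    exact ⟨h1, h2⟩
  · have h1 := dep_succ_le n l j i
    have h2 := dep_le_succ n l j i
    rw [dep_swap13 n i j l, dep_swap13 n i j (l + 1)] at h1 h2
    exact ⟨h1, h2⟩

end Summit.QuantumFields.YangMills.Theorems.FluctuationComparisonRegPrIntLS2BetaCubeRadialProjection
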